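import Mathlib
import Summits.ResolutionOfSingularities.ResolutionOfSingularities.Theorems.HomologicalConductorPersistenceStaircaseRecords
import Summits.ResolutionOfSingularities.ResolutionOfSingularities.Theorems.HomologicalConductorPersistenceCyclicQuotientOneModQ
import HarnessLib

/-!
# Rung S-2 `PersistenceSurface` (stmt-19970), stub C1 (`Sat₄`) — ALL TWO-CURVE cyclic quotients `1/n(1,q)`,
# `n = bq − 1` (`n/q = [b, q]`): `ca(k[u,v]^{μ_n(1,q)}) = ca⁴ = s̲ann(M_{−q}) ∩ s̲ann(M_{−1})`, kernel-certified
# UNIFORMLY in `(b, q)` (chain W4.4b; T-V package, part 28; seat leafhand-res-homologicalconduct-10 gen 2)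

[OURS · L1 w44b · rung S-2] Nothing here is a statement of the manuscript under review (Hironaka 2017);
AI-written, weaker than expert review.

Part 27 (`…CyclicQuotientOneModQ`) certified the family `n ≡ 1 (mod q)`.  This file does the family
`n ≡ −1 (mod q)`: `U = k[u,v]^{μ_n(1,q)}` with `n = bq − 1`, `b, q ≥ 2` (`ζ` a primitive `n`-th root of unity,
`n ∈ kˣ`), i.e. `n/q = b − 1/q = [b, q]` — EXACTLY the cyclic quotient surface singularities whose minimal resolution
has TWO exceptional curves (self-intersections `−b`, `−q`); `e = 2`, `i`-series `(q, 1)`, cospecial pieces `M_{−q}`,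
`M_{−1}`; Gorenstein only for `(b, q) = (2, 2)` (`A₂`); part 25 (`1/n(1,2)`, `n` odd) is the edge `q = 2`.  For a
class `a` with `a.val = α = qA + ρ` (`0 ≤ ρ < q`) the orbit `j ↦ α − qj (mod n)` has the PARAMETRIC record staircase

* `u^{α − qs} v^{s}` for `s ≤ A` (drops `q`), then `u^{ρ − r} v^{A + rb}` for `1 ≤ r ≤ ρ` (each wrap-around lowers
  the record by `1` after `b` steps, since `qb ≡ 1`): drops `1`; so `Ω M_a ≅ M_{−q}^{A} ⊕ M_{−1}^{ρ}`
  (the `e = 2` rows `d₁(α) = ⌊α/q⌋`, `d₂(α) = α mod q` of the LAW table of hand census HAND10G1-QIV-RETRACT §D);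
* Ω-stability: `M_{−q} | Ω M_{−1}` (`α = bq − 2 = (b−1)q + (q−2)`, position `0`) and `M_{−1} | Ω M_{−q}`
  (`α = (b−2)q + (q−1)`, position `b − 2`);
* **`cohomologyAnnihilator_minusOne_mod_q`** — for every `b, q ≥ 2`, `n = bq − 1`: `ca(U) = ca⁴(U)` and
  `x ∈ ca(U) ↔ x ∈ s̲ann(M_{−q}) ∩ s̲ann(M_{−1})`.

The non-linear arithmetic (`q·s`, `r·b`) is isolated in the ring identities `stair_identity`, `drop_identity`,
`cover_identity`; everything else is `omega`.

References: folklore (Auslander 1986 / Herzog 1978 mechanism; Wunram 1988, Riemenschneider 1974 for the classical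
names); res-L1-w44b-idea-1 SC-TORIC v2 and HAND10G1-QIV-RETRACT §D/§F (OURS, memos).
-/

-- single-problem summit: the doubled namespace component `ResolutionOfSingularities` is forced
set_option linter.dupNamespace false

noncomputable section

open CategoryTheory Literature.RingTheory.CohomologyAnnihilator MvPolynomial
open Summit.ResolutionOfSingularities.ResolutionOfSingularities.Theorems.NoZeno.SandwichCluster
open Summit.ResolutionOfSingularities.ResolutionOfSingularities.Theorems.HomologicalConductor.PersistenceAddCoverFamily
open Summit.ResolutionOfSingularities.ResolutionOfSingularities.Theorems.HomologicalConductor.PersistenceCyclicQuotientIsotypic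
open Summit.ResolutionOfSingularities.ResolutionOfSingularities.Theorems.HomologicalConductor.PersistenceCyclicQuotientIsotypicPieces
open Summit.ResolutionOfSingularities.ResolutionOfSingularities.Theorems.HomologicalConductor.PersistenceStaircaseRecords
open Summit.ResolutionOfSingularities.ResolutionOfSingularities.Theorems.HomologicalConductor.PersistenceCyclicQuotientOneModQ
  (natCast_val_add_mul_self val_sub_natCast_eq val_neg_natCast)

universe u

namespace Summit.ResolutionOfSingularities.ResolutionOfSingularities.Theorems.HomologicalConductor.PersistenceCyclicQuotientMinusOneModQ

/-! ## Arithmetic: the three ring identities (the `ZMod n` cast lemmas are part 27's) -/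

/-- The generators after `A`: `(ρ − r) + q (A + r b) = (qA + ρ) + r (bq − 1)` (`r ≤ ρ`). [folklore] -/
theorem stair_identity (q b A ρ r : ℕ) (hr : r ≤ ρ) (hbq : 1 ≤ b * q) :
    ρ - r + q * (A + r * b) = q * A + ρ + r * (b * q - 1) := by
  zify [hr, hbq]
  ring

/-- The drop between consecutive late generators: `(ρ − r) + q (A + (r+1) b) = (qA + ρ) + (r+1)(bq − 1) + 1`
(`r + 1 ≤ ρ`). [folklore] -/
theorem drop_identity (q b A ρ r : ℕ) (hr : r + 1 ≤ ρ) (hbq : 1 ≤ b * q) :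
    ρ - r + q * (A + (r + 1) * b) = q * A + ρ + (r + 1) * (b * q - 1) + 1 := by
  zify [(by omega : r ≤ ρ), hbq]
  ring

/-- Cover identity between two late generators (`r + 1 ≤ ρ`, `1 ≤ m ≤ b`):
`(ρ − r − 1 + q (b − m)) + q (A + r b + m) = (qA + ρ) + (r + 1)(bq − 1)`. [folklore] -/
theorem cover_identity (q b A ρ r m : ℕ) (hr : r + 1 ≤ ρ) (hm : m ≤ b) (hbq : 1 ≤ b * q) :
    ρ - r - 1 + q * (b - m) + q * (A + r * b + m) = q * A + ρ + (r + 1) * (b * q - 1) := by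
  zify [hm, hbq, (by omega : 1 ≤ ρ - r), (by omega : r ≤ ρ)]
  ring

/-! ## The certificate -/

variable {k : Type u} [Field k] {n : ℕ} [NeZero n] {ζ : k} (hζ : IsPrimitiveRoot ζ n) (hn : (n : k) ≠ 0)
variable {q : ℕ} (U : Subalgebra k (MvPolynomial (Fin 2) k))
variable (hU : ∀ p, p ∈ U ↔ aeval (fun i : Fin 2 => C (ζ ^ (![1, q] : Fin 2 → ℕ) i) * X i) p = p)

set_option maxHeartbeats 1600000 in
set_option synthInstance.maxHeartbeats 400000 in
include hζ hn hU in
/-- **`Sat₄` and the exact centre for `k[u,v]^{μ_n(1,q)}` whenever `n = bq − 1` (`b, q ≥ 2`) — every cyclic quotient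
surface singularity with a two-curve resolution graph `[b, q]` — kernel-certified uniformly in `(b, q)`.**  With the
weight pieces `M a = {p | σ₀ p = ζ^a p}` (`σ₀ : u ↦ ζu, v ↦ ζ^{q}v`): `ca(U) = ca⁴(U)` and `x ∈ ca(U) ↔ x` stably
annihilates `M_{−q}` and `M_{−1}` (the duals of the specials `M_q = M_{i₁}`, `M_1 = M_{i₂}`).
(Budgets raised locally as in parts 21–27.) [OURS · L1 w44b] -/
theorem cohomologyAnnihilator_minusOne_mod_q (b : ℕ) (hb : 2 ≤ b) (hq : 2 ≤ q) (hnq : n = b * q - 1) :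
    ∃ M : ZMod n → Submodule U ((restrictScalarsFunctor U (MvPolynomial (Fin 2) k)).obj
        (ModuleCat.of (MvPolynomial (Fin 2) k) (MvPolynomial (Fin 2) k))),
      (∀ (a : ZMod n) (p : MvPolynomial (Fin 2) k),
        (show ((restrictScalarsFunctor U (MvPolynomial (Fin 2) k)).obj
          (ModuleCat.of (MvPolynomial (Fin 2) k) (MvPolynomial (Fin 2) k))) from p) ∈ M a ↔
        aeval (fun i : Fin 2 => C (ζ ^ (![1, q] : Fin 2 → ℕ) i) * X i) p = C (ζ ^ a.val) * p) ∧
      cohomologyAnnihilator U = cohomologyAnnihilatorOfDegree U 4 ∧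
      ∀ x : U, x ∈ cohomologyAnnihilator U ↔
        ∀ t : Fin 2, StablyAnnihilates U x
          (@ModuleCat.of U _ (M (![-((q : ℕ) : ZMod n), -((1 : ℕ) : ZMod n)] t)) _
            (M (![-((q : ℕ) : ZMod n), -((1 : ℕ) : ZMod n)] t)).module) := by
  classical
  have hbq : 1 ≤ b * q := by nlinarith
  have hbq4 : 4 ≤ b * q := by nlinarith
  have hcop : Nat.Coprime q n := by
    -- `q · b = n + 1`, so a common divisor of `q` and `n` divides `1`
    rw [Nat.coprime_comm, Nat.coprime_iff_gcd_eq_one]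
    have h1 : Nat.gcd n q ∣ n := Nat.gcd_dvd_left n q
    have h2 : Nat.gcd n q ∣ b * q := Dvd.dvd.mul_left (Nat.gcd_dvd_right n q) b
    have h3 : Nat.gcd n q ∣ b * q - n := Nat.dvd_sub h2 h1
    rw [show b * q - n = 1 by omega] at h3
    exact Nat.dvd_one.mp h3
  obtain ⟨M, hM, ⟨e⟩⟩ := exists_isotypic_splitting hζ hn hcop U hU
  have hqn : q < n := by have := Nat.mul_le_mul_right q hb; omega
  have hval : ∀ a : ZMod n, a.val < n := fun a => ZMod.val_lt a
  have hdm : ∀ a : ZMod n, q * (a.val / q) + a.val % q = a.val := fun a => Nat.div_add_mod _ _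
  have hml : ∀ a : ZMod n, a.val % q < q := fun a => Nat.mod_lt _ (by omega)
  -- per-class staircase data, `α = a.val = q A + ρ`; late generators indexed by `r = min (s − A) ρ`
  let A : ZMod n → ℕ := fun a => a.val / q
  let ρ : ZMod n → ℕ := fun a => a.val % q
  let μ : ZMod n → ℕ := fun a => A a + ρ a
  let J : ZMod n → ℕ := fun a => A a + ρ a * b
  let c : ZMod n → ℕ → ℕ := fun a s => if s ≤ A a then a.val - q * s else ρ a - min (s - A a) (ρ a)
  let j : ZMod n → ℕ → ℕ := fun a s => if s ≤ A a then s else A a + min (s - A a) (ρ a) * b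
  let d : ZMod n → ℕ → ZMod n := fun a t => if t < A a then -((q : ℕ) : ZMod n) else -((1 : ℕ) : ZMod n)
  have hc_anti : ∀ a, Antitone (c a) := by
    intro a s t hst
    have hA := hdm a
    have := Nat.mul_le_mul_left q hst
    have h2 : s ≤ a.val / q → q * s ≤ q * (a.val / q) := fun h => Nat.mul_le_mul_left q h
    dsimp only [c, A, ρ]
    split_ifs <;> omega
  have hj_mono : ∀ a, Monotone (j a) := by
    intro a s t hst
    have := Nat.mul_le_mul_right b (show min (s - a.val / q) (a.val % q) ≤ min (t - a.val / q) (a.val % q) by omega)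
    dsimp only [j, A, ρ]
    split_ifs <;> omega
  -- the class of every generator
  have hcl : ∀ a s, ((c a s + q * j a s : ℕ) : ZMod n) = a := by
    intro a s
    have hA := hdm a
    dsimp only [c, j, A, ρ]
    by_cases hs : s ≤ a.val / q
    · have := Nat.mul_le_mul_left q hs
      rw [if_pos hs, if_pos hs, show a.val - q * s + q * s = a.val by omega, ZMod.natCast_zmod_val]
    · rw [if_neg hs, if_neg hs, stair_identity q b (a.val / q) (a.val % q) _ (min_le_right _ _) hbq, hA, ← hnq,
        natCast_val_add_mul_self]
  -- the drop classes: `−q` below `A`, `−1` from `A` to `μ`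
  have hψ : ∀ a t, t < μ a → d a t = a - ((c a t + q * j a (t + 1) : ℕ) : ZMod n) := by
    intro a t ht
    have hA := hdm a
    dsimp only [μ, A, ρ] at ht
    dsimp only [d, c, j, A, ρ]
    by_cases htA : t < a.val / q
    · have := Nat.mul_le_mul_left q (le_of_lt htA)
      rw [if_pos htA, if_pos (le_of_lt htA), if_pos (Nat.succ_le_of_lt htA),
        show a.val - q * t + q * (t + 1) = a.val + q by rw [Nat.mul_succ]; omega, Nat.cast_add,
        ZMod.natCast_zmod_val]
      ring
    · rw [if_neg htA]
      by_cases htA' : t ≤ a.val / q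
      · -- `t = A`: the generator `u^ρ v^A`, next generator `u^{ρ−1} v^{A+b}`
        have ht0 : t = a.val / q := by omega
        rw [if_pos htA', if_neg (show ¬ (t + 1 ≤ a.val / q) by omega), ht0,
          show a.val - q * (a.val / q) = a.val % q - 0 by omega,
          show min (a.val / q + 1 - a.val / q) (a.val % q) = 0 + 1 by omega,
          drop_identity q b (a.val / q) (a.val % q) 0 (by omega) hbq, hA, ← hnq, Nat.cast_add,
          natCast_val_add_mul_self, Nat.cast_one]
        ring
      · rw [if_neg htA', if_neg (show ¬ (t + 1 ≤ a.val / q) by omega),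
          show min (t + 1 - a.val / q) (a.val % q) = (t - a.val / q) + 1 by omega,
          show min (t - a.val / q) (a.val % q) = t - a.val / q by omega,
          drop_identity q b (a.val / q) (a.val % q) (t - a.val / q) (by omega) hbq, hA, ← hnq, Nat.cast_add,
          natCast_val_add_mul_self, Nat.cast_one]
        ring
  -- `q J ≡ a`
  have hJ : ∀ a, ((q * J a : ℕ) : ZMod n) = a := by
    intro a
    have hA := hdm a
    dsimp only [J, A, ρ]
    have h := stair_identity q b (a.val / q) (a.val % q) (a.val % q) le_rfl hbq
    rw [Nat.sub_self, zero_add, hA, ← hnq] at h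
    rw [h, natCast_val_add_mul_self]
  -- the cover property of the staircase on `[0, J]`
  have hcov : ∀ a i, i ≤ J a → ∃ s, s ≤ μ a ∧ j a s ≤ i ∧ c a s ≤ ((a - ((q * i : ℕ) : ZMod n) : ZMod n)).val := by
    intro a i hi
    have hA := hdm a
    have hρq := hml a
    have hlt := hval a
    dsimp only [J, μ, c, j, A, ρ] at hi ⊢
    by_cases hiA : i ≤ a.val / q
    · have := Nat.mul_le_mul_left q hiA
      refine ⟨i, by omega, ?_, ?_⟩
      · rw [if_pos hiA]
      · rw [if_pos hiA, val_sub_natCast_eq a (v := a.val - q * i) (w := 0) (by omega) (by omega)]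
    · -- `i = A + (r b + m)` with `m < b`; the generator `u^{ρ−r} v^{A+rb}` covers `i`
      obtain ⟨m₀, hm₀⟩ := Nat.exists_eq_add_of_le (le_of_not_ge hiA)
      obtain ⟨r, m, hrm, hmb⟩ : ∃ r m : ℕ, b * r + m = m₀ ∧ m < b :=
        ⟨m₀ / b, m₀ % b, Nat.div_add_mod _ _, Nat.mod_lt _ (by omega)⟩
      have hrρ : r ≤ a.val % q := by
        by_contra hlt'
        have h' := Nat.mul_le_mul_left b (show a.val % q + 1 ≤ r by omega)
        have e1 : b * (a.val % q + 1) = a.val % q * b + b := by ring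
        omega
      have hrb : b * r = r * b := Nat.mul_comm _ _
      -- the values of the covering generator `s = A + r` (uniform in `r = 0` / `r > 0`)
      have hjs : (if a.val / q + r ≤ a.val / q then a.val / q + r
          else a.val / q + min (a.val / q + r - a.val / q) (a.val % q) * b) = a.val / q + r * b := by
        by_cases hr0 : r = 0
        · subst hr0
          rw [zero_mul, Nat.add_zero, if_pos le_rfl]
        · rw [if_neg (by omega), show min (a.val / q + r - a.val / q) (a.val % q) = r by omega]
      have hcs : (if a.val / q + r ≤ a.val / q then a.val - q * (a.val / q + r)
          else a.val % q - min (a.val / q + r - a.val / q) (a.val % q)) = a.val % q - r := by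
        by_cases hr0 : r = 0
        · subst hr0
          rw [Nat.add_zero, if_pos le_rfl]
          omega
        · rw [if_neg (by omega), show min (a.val / q + r - a.val / q) (a.val % q) = r by omega]
      refine ⟨a.val / q + r, by omega, ?_, ?_⟩
      · rw [hjs]
        omega
      · rw [hcs]
        by_cases hm0 : m = 0
        · -- on the generator itself: value `ρ − r`
          have hid := stair_identity q b (a.val / q) (a.val % q) r hrρ hbq
          rw [hA, ← hnq] at hid
          rw [val_sub_natCast_eq a (v := a.val % q - r) (w := r) (by omega)
            (by rw [hm₀, show a.val / q + m₀ = a.val / q + r * b by omega]; exact hid)]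
        · -- strictly between two late generators: value `ρ − r − 1 + q (b − m) ≥ ρ − r`
          have hrρ' : r + 1 ≤ a.val % q := by
            by_contra hlt'
            have : r = a.val % q := by omega
            subst this
            omega
          have hid := cover_identity q b (a.val / q) (a.val % q) r m hrρ' hmb.le hbq
          rw [hA, ← hnq] at hid
          have hqm : q ≤ q * m := Nat.le_mul_of_pos_right q (by omega)
          have hqbm : q ≤ q * (b - m) := Nat.le_mul_of_pos_right q (by omega)
          have hbm : q * (b - m) + q * m = b * q := by rw [← Nat.mul_add, Nat.sub_add_cancel hmb.le, Nat.mul_comm]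
          rw [val_sub_natCast_eq a (v := a.val % q - r - 1 + q * (b - m)) (w := r + 1) (by omega)
            (by rw [hm₀, show a.val / q + m₀ = a.val / q + r * b + m by omega]; exact hid)]
          omega
  -- the staircase resolutions `Ω M_a ≅ Π_{t < μ a} M (d a t)`
  let M' : ZMod n → ModuleCat.{u} U := fun a => @ModuleCat.of U _ (M a) _ (M a).module
  let K : ZMod n → ModuleCat.{u} U := fun a => ModuleCat.of U (Π t : Fin (μ a), M (d a t))
  have hK : ∀ a, IsSyzygy 1 (M' a) (K a) := by
    intro a
    refine isSyzygy_one_staircase_of_lt hζ U hU M hM a (μ a) (c a) (j a) (hc_anti a) (hj_mono a) (hcl a)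
      (d a) (hψ a) ?_
    exact isotypic_le_span_of_cover hζ U hU M hM a (μ a) (J a) (c a) (j a) (hcl a) (hJ a) (hcov a)
  -- the certificate data: distinguished family `{M_{−q}, M_{−1}}`
  let ψ' : Fin 2 → ZMod n := ![-((q : ℕ) : ZMod n), -((1 : ℕ) : ZMod n)]
  have hdψ : ∀ a t, ∃ s : Fin 2, d a t = ψ' s := by
    intro a t
    dsimp only [d]
    by_cases ht : t < A a
    · exact ⟨0, by rw [if_pos ht]; rfl⟩
    · exact ⟨1, by rw [if_neg ht]; rfl⟩
  have hfin : ∀ t, Module.Finite U (M' (ψ' t)) := fun t => finite_isotypic hζ q U hU M hM _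
  have hKD : ∀ a, IsRetractOfPower (ModuleCat.of U ((Π t, M' (ψ' t)) × U)) (K a) := by
    intro a
    refine IsRetractOfPower.piFamily (fun t : Fin (μ a) => M' (d a t)) fun t => ?_
    obtain ⟨s, heq⟩ := hdψ a t
    exact (isRetractOfPower_fst (ModuleCat.of U (Π t, M' (ψ' t))) (ModuleCat.of U U)).of_isRetractOfPower_gen
      ((isRetractOfPower_eval (fun t : Fin 2 => M' (ψ' t)) s).of_iso
        (LinearEquiv.toModuleIso (LinearEquiv.ofEq _ _ (by rw [heq]))))
  have hD : ∀ t, ∃ (s : Fin 2) (i : M' (ψ' t) ⟶ K (ψ' s)) (r : K (ψ' s) ⟶ M' (ψ' t)),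
      i ≫ r = 𝟙 (M' (ψ' t)) := by
    -- `M_{−q} | Ω M_{−1}` at position `0` (`(−1).val = bq − 2 = (b−1)q + (q−2)`, `A = b − 1 ≥ 1`);
    -- `M_{−1} | Ω M_{−q}` at position `b − 2` (`(−q).val = bq − 1 − q = (b−2)q + (q−1)`, `A = b − 2`, `ρ = q − 1`)
    have hv1 : (ψ' 1).val = n - 1 := val_neg_natCast (by norm_num) (by omega)
    have hvq : (ψ' 0).val = n - q := val_neg_natCast (by omega) (by omega)
    have hAρ1 : A (ψ' 1) = b - 1 ∧ ρ (ψ' 1) = q - 2 := by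
      refine (Nat.div_mod_unique (by omega)).mpr ⟨?_, by omega⟩
      rw [hv1, hnq]
      obtain ⟨b', rfl⟩ : ∃ b', b = b' + 1 := ⟨b - 1, by omega⟩
      have hcomm : q * b' = b' * q := Nat.mul_comm _ _
      rw [Nat.add_sub_cancel, Nat.add_mul, one_mul]
      omega
    have hAρq : A (ψ' 0) = b - 2 ∧ ρ (ψ' 0) = q - 1 := by
      refine (Nat.div_mod_unique (by omega)).mpr ⟨?_, by omega⟩
      rw [hvq, hnq]
      obtain ⟨b', rfl⟩ : ∃ b', b = b' + 2 := ⟨b - 2, by omega⟩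
      have hcomm : q * b' = b' * q := Nat.mul_comm _ _
      rw [Nat.add_sub_cancel, Nat.add_mul]
      omega
    have hsrc : ∀ t : Fin 2, ∃ (s : Fin 2) (p : Fin (μ (ψ' s))), d (ψ' s) p = ψ' t := by
      intro t
      fin_cases t
      · have hμs : μ (ψ' 1) = b - 1 + (q - 2) := by simp only [μ, hAρ1.1, hAρ1.2]
        refine ⟨1, ⟨0, by rw [hμs]; omega⟩, ?_⟩
        change d (ψ' 1) 0 = ψ' 0
        simp only [d, hAρ1.1]
        rw [if_pos (by omega)]
        rfl
      · have hμs : μ (ψ' 0) = b - 2 + (q - 1) := by simp only [μ, hAρq.1, hAρq.2]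
        refine ⟨0, ⟨b - 2, by rw [hμs]; omega⟩, ?_⟩
        change d (ψ' 0) (b - 2) = ψ' 1
        simp only [d, hAρq.1, lt_irrefl, if_false]
        rfl
    intro t
    obtain ⟨s, p, hp⟩ := hsrc t
    let E : M (d (ψ' s) p) ≃ₗ[U] M (ψ' t) := LinearEquiv.ofEq _ _ (by rw [hp])
    refine ⟨s,
      @ModuleCat.ofHom U _ (M (ψ' t)) (Π t' : Fin (μ (ψ' s)), M (d (ψ' s) t'))
        _ (M (ψ' t)).module _ _
        ((LinearMap.single U (fun t' : Fin (μ (ψ' s)) => M (d (ψ' s) t')) p) ∘ₗ E.symm.toLinearMap),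
      @ModuleCat.ofHom U _ (Π t' : Fin (μ (ψ' s)), M (d (ψ' s) t')) (M (ψ' t))
        _ _ _ (M (ψ' t)).module (E.toLinearMap ∘ₗ LinearMap.proj p), ?_⟩
    apply ModuleCat.hom_ext
    refine LinearMap.ext fun x => ?_
    change E ((Pi.single p (E.symm x) : Π t' : Fin (μ (ψ' s)), M (d (ψ' s) t')) p) = x
    rw [Pi.single_eq_same, LinearEquiv.apply_symm_apply]
  obtain ⟨h4, hiff⟩ := @cohomologyAnnihilator_eq_four_of_isotypicData k _ n _ ζ hζ hn q hcop U hU (Fin 2) _ M' e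
    K hK ψ' hfin hKD hD
  exact ⟨M, hM, h4, hiff⟩

end Summit.ResolutionOfSingularities.ResolutionOfSingularities.Theorems.HomologicalConductor.PersistenceCyclicQuotientMinusOneModQ

end
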